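import Summits.NavierStokesRegularity.NavierStokesRegularity.Theorems.SqueezeCycleSingularProfileOfNontrivialTypeIBound
import Summits.NavierStokesRegularity.NavierStokesRegularity.Theorems.AdaptedFrequencyTangentFlowTransferAncientPressure
import Literature.Analysis.FluidPDE.LocalTypeI
import Literature.Analysis.FluidPDE.ClassicalSuitable
import Literature.Analysis.FluidPDE.SuitableWeakPressure
import Literature.Analysis.FluidPDE.NormalisedPressure
import Literature.Analysis.FluidPDE.BallCutoff
import HarnessLib

/-!
# Crux `ClockStretchingLaw.ClockLaw` (stmt-NavierStokesRegularity-10571), line `registered`: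
# `stub_classPressure` — the class pressure with a uniform bound (unconditionally)

Stub 6 of the birth line of the crux `ClockLaw` (lead revision r1), registered as
`PressureRepr → ClassPressure`. We prove the consequent `ClassPressure` OUTRIGHT
(`classPressure_holds`), from proved tree theorems of the route `SqueezeCycle`
(item `SingularProfileOfNontrivial`): for every `C` there is `K = K(C)` such that every Type-I
KNSS-mild field `u` (`IsTypeIAncientMild C u`) with the energy ledger `A, E ≤ C` is, with SOME
pressure `p`, a suitable weak solution in the unit parabolic ball `Q(0,1)` in the class of
Albritton–Barker Def. 2.1 (`IsSuitableWeakSolutionInBall 1 0 u p`) with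
`‖u‖_{L³(Q(0,1))} ≤ K` and `‖p‖_{L^{3/2}(Q(0,1))} ≤ K`. The registered stub follows a fortiori.

* THE PRESSURE. A Type-I KNSS-mild field is a classical solution on the whole slab `(−∞, 0)` for
  one smooth pressure `q` (`exists_isClassicalNSSolutionOn_Iio_of_isTypeIAncientMild`:
  Fabes–Jones–Rivière pressures on windows, patched); we take the MEAN-FREE normalisation
  `p(t, x) = q(t, x) − ⨍_{B(0,1)} q(t, ·)` (Albritton–Barker 2019, §1: the quantity `D` is
  mean-free; the pressure of a suitable weak solution is free up to a function of time,
  `IsSuitableWeakSolutionOn.sub_pressure`).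
* SUITABILITY in `Q(0,1)`: classical ⇒ suitable on the open cylinder, which lies in the open slab
  (`isSuitableWeakSolutionOn_of_contDiffOn`, CKN 1982 §2); the subtracted mean is continuous in
  `t < 0` (`SingularProfile.continuousOn_ballMean`), hence locally integrable and locally `L^{3/2}`
  on the open cylinder.
* THE GLOBAL CLASS AND THE BOUNDS, uniform in the class (Albritton–Barker 2019, Rem. 3.2 and §3):
  `A(1) ≤ C` (`SingularProfile.cknAEss_unit_le`), `E(1) ≤ 3C` for the classical gradient
  (`SingularProfile.cknE_unit_le`), `C(1) ≤ 2C²` (`SingularProfile.cknC_unit_le`: Type-I rate times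
  local energy), and the heart, `D(1) ≤ K_D(C)` (`SingularProfile.exists_cknDOsc_unit_bound`: the
  classical pressure is the Riesz pressure up to a function of time, Tao's probe argument in the
  Morrey class, Calderón–Zygmund near the ball and the Morrey far field); so
  `‖u‖_{L³(Q(0,1))} ≤ (2C²)^{1/3}` and `‖p‖_{L^{3/2}(Q(0,1))} = D(1)^{2/3} ≤ K_D(C)^{2/3}`.

References: D. Albritton, T. Barker, arXiv:1811.00502, Def. 2.1, Rem. 3.2, §3 [AlbrittonBarker2019];
L. Caffarelli, R. Kohn, L. Nirenberg, CPAM 35 (1982), §2 [CaffarelliKohnNirenberg1982];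
T. Tao, Anal. PDE 6 (2013), §4, Lemma 4.1 [Tao2011].
-/

noncomputable section

open MeasureTheory Filter Topology Set Metric Function
open Literature.Analysis Literature.Analysis.FluidPDE
open scoped Topology NNReal ENNReal InnerProductSpace RealInnerProductSpace

-- Summit = Problem namespace duplication is the tree's layout (CONVENTIONS §1); as in every Theorems file.
set_option linter.dupNamespace false

namespace Summit.NavierStokesRegularity.NavierStokesRegularity.Theorems.ClockLaw.Birth

/-- Local notation: `ℝ³`. -/
local notation "E3" => EuclideanSpace ℝ (Fin 3)

/-! ### Arithmetic of the exponent `3/2` -/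

/-- `(3/2 : ℝ≥0∞) ≠ 0`, `≠ ∞`, `1 ≤ 3/2`, `(3/2).toReal = 3/2`. [folklore] -/
theorem classPressure_threeHalves :
    (3 / 2 : ℝ≥0∞) ≠ 0 ∧ (3 / 2 : ℝ≥0∞) ≠ ∞ ∧ (1 : ℝ≥0∞) ≤ 3 / 2 ∧
      (3 / 2 : ℝ≥0∞).toReal = 3 / 2 := by
  refine ⟨(ENNReal.div_pos_iff.2 ⟨by norm_num, by norm_num⟩).ne',
    ENNReal.div_ne_top (by norm_num) (by norm_num), ?_, ?_⟩
  · rw [ENNReal.le_div_iff_mul_le (by norm_num) (by norm_num)]; norm_num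
  · rw [ENNReal.toReal_div]; norm_num

/-! ### A Type-I model with its classical pressure in the unit parabolic ball -/

section Ball

variable {C : ℝ} {u : ℝ → E3 → E3} {q : ℝ → E3 → ℝ}

/-- **Classical ⇒ suitable in the unit parabolic ball**: a classical solution on the slab
`(−∞,0) × ℝ³` is a suitable weak solution on the open cylinder `Q(0,1)`
(`isSuitableWeakSolutionOn_of_contDiffOn`; Caffarelli–Kohn–Nirenberg 1982, §2).
[cite: CaffarelliKohnNirenberg1982, §2 (2.1)–(2.5)] -/
theorem classPressure_suitable_of_classical
    (hq : IsClassicalNSSolutionOn (Iio 0) 1 0 u q) :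
    IsSuitableWeakSolutionOn (parabolicCylinderOpens 1 (0 : ℝ × E3)) 1 0 u q := by
  -- adapted from `squeezeCycle_slabProfile_of_modelClass`
  -- (Theorems/SqueezeCycleSingularProfileOfNontrivial)
  refine isSuitableWeakSolutionOn_of_contDiffOn isOpen_Iio (parabolicCylinder_origin_subset_slab 1)
    (hq.smooth_velocity.of_le (by norm_cast)) (hq.smooth_pressure.of_le (by norm_cast))
    continuousOn_const (fun t ht x => ?_) hq.divFree
  have hm := hq.momentum t ht x
  rwa [timeDerivWithin_apply, derivWithin_of_isOpen isOpen_Iio ht, ← timeDeriv_apply] at hm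

/-- **The mean-free normalisation keeps suitability**: with `q` a classical pressure of `u` on
the slab, `(u, q − ⨍_{B(0,1)} q(t,·))` is a suitable weak solution on `Q(0,1)` — the subtracted
function of time is continuous on `t < 0` (`SingularProfile.continuousOn_ballMean`), hence locally
integrable and locally `L^{3/2}` on the open cylinder (`IsSuitableWeakSolutionOn.sub_pressure`;
Lin 1998, §3; Albritton–Barker 2019, §1, the mean-free `D`). [cite: AlbrittonBarker2019, §1] -/
theorem classPressure_suitable_meanFree
    (hq : IsClassicalNSSolutionOn (Iio 0) 1 0 u q) :
    IsSuitableWeakSolutionOn (parabolicCylinderOpens 1 (0 : ℝ × E3)) 1 0 u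
      fun t x => q t x - ⨍ y in ball (0 : E3) 1, q t y := by
  have hQ1m : MeasurableSet (parabolicCylinder 1 (0 : ℝ × E3)) :=
    (isOpen_parabolicCylinder 1 0).measurableSet
  have hqc : ContinuousOn (uncurry q) (Iio (0 : ℝ) ×ˢ (univ : Set E3)) :=
    hq.smooth_pressure.continuousOn
  have hmc : ContinuousOn (fun z : ℝ × E3 => ⨍ y in ball (0 : E3) 1, q z.1 y)
      (Iio (0 : ℝ) ×ˢ (univ : Set E3)) :=
    (SingularProfile.continuousOn_ballMean hqc).comp continuous_fst.continuousOn fun z hz => hz.1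
  refine (classPressure_suitable_of_classical hq).sub_pressure
    (c := fun t => ⨍ y in ball (0 : E3) 1, q t y)
    ((hmc.mono (parabolicCylinder_origin_subset_slab 1)).locallyIntegrableOn hQ1m)
    fun K hK hKc => ?_
  -- the mean is bounded on the compact `K ⊆ Q(0,1)`
  obtain ⟨M, hM⟩ := hKc.exists_bound_of_continuousOn
    (hmc.mono (hK.trans (parabolicCylinder_origin_subset_slab 1)))
  calc ∫⁻ z in K, ‖⨍ y in ball (0 : E3) 1, q z.1 y‖ₑ ^ (3 / 2 : ℝ)
      ≤ ∫⁻ z in K, ENNReal.ofReal M ^ (3 / 2 : ℝ) := by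
        refine setLIntegral_mono' hKc.isClosed.measurableSet fun z hz => ?_
        refine ENNReal.rpow_le_rpow ?_ (by norm_num)
        rw [← ofReal_norm]
        exact ENNReal.ofReal_le_ofReal (hM z hz)
    _ < ∞ := by
        rw [setLIntegral_const]
        exact ENNReal.mul_lt_top (ENNReal.rpow_lt_top_of_nonneg (by norm_num) ENNReal.ofReal_ne_top)
          hKc.measure_lt_top

/-- **The mean-free classical pressure is jointly measurable on `Q(0,1)`** (continuous on the
open slab). [folklore] -/
theorem classPressure_aestronglyMeasurable_meanFree (hq : IsClassicalNSSolutionOn (Iio 0) 1 0 u q) :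
    AEStronglyMeasurable (uncurry fun t x => q t x - ⨍ y in ball (0 : E3) 1, q t y)
      (volume.restrict (parabolicCylinder 1 (0 : ℝ × E3))) := by
  have hqc : ContinuousOn (uncurry q) (Iio (0 : ℝ) ×ˢ (univ : Set E3)) :=
    hq.smooth_pressure.continuousOn
  have hmc : ContinuousOn (fun z : ℝ × E3 => ⨍ y in ball (0 : E3) 1, q z.1 y)
      (Iio (0 : ℝ) ×ˢ (univ : Set E3)) :=
    (SingularProfile.continuousOn_ballMean hqc).comp continuous_fst.continuousOn fun z hz => hz.1
  exact ((hqc.sub hmc).mono (parabolicCylinder_origin_subset_slab 1)).aestronglyMeasurable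
    (isOpen_parabolicCylinder 1 0).measurableSet

/-- **`‖q − [q]‖^{3/2}_{L^{3/2}(Q(0,1))} = D(1)`**: a bound on Albritton–Barker's mean-free pressure
quantity `D(Q(0,1)) = cknDOsc 1 0 q` is a bound on `∫⁻_{Q(0,1)} |q − ⨍_{B(0,1)} q(t,·)|^{3/2}`.
[cite: AlbrittonBarker2019, §1 (the quantity D)] -/
theorem classPressure_lintegral_meanFree_le {KD : ℝ≥0∞} (h : cknDOsc 1 (0 : ℝ × E3) q ≤ KD) :
    ∫⁻ z in parabolicCylinder 1 (0 : ℝ × E3),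
        ‖q z.1 z.2 - ⨍ y in ball (0 : E3) 1, q z.1 y‖ₑ ^ (3 / 2 : ℝ) ≤ KD := by
  unfold cknDOsc at h
  rw [ENNReal.ofReal_one, one_pow, inv_one, one_mul] at h
  simpa only [Prod.snd_zero] using h

end Ball

/-! ### `ClassPressure`, unconditionally -/

/-- **The class pressure with a uniform bound** (the consequent `ClassPressure` of the stub,
proved outright): for every `C` there is `K = K(C)` such that every Type-I KNSS-mild field with the
energy ledger `A, E ≤ C` is, with the mean-free normalisation `p = q − ⨍_{B(0,1)} q(t,·)` of its
classical slab pressure `q`, a suitable weak solution in `Q(0,1)` in the class of Albritton–Barker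
Def. 2.1 with `‖u‖_{L³(Q(0,1))} ≤ K` and `‖p‖_{L^{3/2}(Q(0,1))} ≤ K`;
`K = ((2C²)^{1/3} + K_D(C)^{2/3})` (`A ≤ C`, `C ≤ 2C²`, `D ≤ K_D(C)`, `E ≤ 3C` on the unit ball,
route `SqueezeCycle`). [cite: AlbrittonBarker2019, Def. 2.1, Rem. 3.2 and §3] -/
theorem classPressure_holds (C : ℝ) :
    ∃ K : NNReal, ∀ u : ℝ → E3 → E3, IsTypeIAncientMild C u →
      (∀ (x₀ : EuclideanSpace ℝ (Fin 3)) (t₀ r : ℝ), t₀ ≤ 0 → 0 < r →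
        (∀ t, t₀ - r ^ 2 < t → t < t₀ → r⁻¹ * ∫ x in Metric.ball x₀ r, ‖u t x‖ ^ 2 ≤ C) ∧
          r⁻¹ * ∫ t in Set.Ioo (t₀ - r ^ 2) t₀, ∫ x in Metric.ball x₀ r, ‖fderiv ℝ (u t) x‖ ^ 2 ≤ C) →
      ∃ p : ℝ → E3 → ℝ, IsSuitableWeakSolutionInBall 1 0 u p ∧
        eLpNorm (Function.uncurry u) 3
            (volume.restrict (parabolicCylinder 1 (0 : ℝ × E3))) ≤ K ∧
        eLpNorm (Function.uncurry p) (3 / 2)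
            (volume.restrict (parabolicCylinder 1 (0 : ℝ × E3))) ≤ K := by
  obtain ⟨h32z, h32t, -, h32⟩ := classPressure_threeHalves
  -- the constants
  set Ku : ℝ≥0∞ := ENNReal.ofReal (2 * C ^ 2) ^ (1 / 3 : ℝ) with hKu
  set Kp : ℝ≥0∞ := SingularProfile.exists_cknDOsc_unit_bound.choose C ^ (2 / 3 : ℝ) with hKp
  have hKut : Ku ≠ ∞ := ENNReal.rpow_ne_top_of_nonneg (by norm_num) ENNReal.ofReal_ne_top
  have hKpt : Kp ≠ ∞ := ENNReal.rpow_ne_top_of_nonneg (by norm_num)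
    (SingularProfile.exists_cknDOsc_unit_bound.choose_spec.1 C)
  refine ⟨(Ku + Kp).toNNReal, fun u hu hled => ?_⟩
  rw [ENNReal.coe_toNNReal (ENNReal.add_ne_top.2 ⟨hKut, hKpt⟩)]
  -- the classical slab pressure and its mean-free normalisation
  obtain ⟨q, hq⟩ := exists_isClassicalNSSolutionOn_Iio_of_isTypeIAncientMild hu
  set p : ℝ → E3 → ℝ := fun t x => q t x - ⨍ y in ball (0 : E3) 1, q t y with hp
  -- (1) the velocity bound `‖u‖_{L³(Q(0,1))} ≤ (2C²)^{1/3}`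
  have hu3 : eLpNorm (uncurry u) 3 (volume.restrict (parabolicCylinder 1 (0 : ℝ × E3))) ≤ Ku := by
    have h := SingularProfile.cknC_unit_le hu hled
    unfold cknC at h
    rw [ENNReal.ofReal_one, one_pow, inv_one, one_mul] at h
    rw [hKu, eLpNorm_eq_lintegral_rpow_enorm_toReal (by norm_num) (by norm_num),
      ENNReal.toReal_ofNat]
    refine ENNReal.rpow_le_rpow (le_of_eq_of_le (lintegral_congr fun w => ?_) h) (by norm_num)
    show ‖u w.1 w.2‖ₑ ^ (3 : ℝ) = ‖u w.1 w.2‖ₑ ^ (3 : ℕ)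
    rw [← ENNReal.rpow_natCast]
    norm_num
  -- (2) the pressure bound `‖p‖_{L^{3/2}(Q(0,1))} ≤ K_D(C)^{2/3}`
  have hp32 : eLpNorm (uncurry p) (3 / 2) (volume.restrict (parabolicCylinder 1 (0 : ℝ × E3))) ≤
      Kp := by
    rw [hKp, eLpNorm_eq_lintegral_rpow_enorm_toReal h32z h32t, h32,
      show (1 / (3 / 2 : ℝ)) = 2 / 3 by norm_num]
    exact ENNReal.rpow_le_rpow (classPressure_lintegral_meanFree_le
      (SingularProfile.exists_cknDOsc_unit_bound.choose_spec.2 C u q hu hled hq)) (by norm_num)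
  have hpLp : MemLp (uncurry p) (3 / 2) (volume.restrict (parabolicCylinder 1 (0 : ℝ × E3))) :=
    ⟨classPressure_aestronglyMeasurable_meanFree hq, lt_of_le_of_lt hp32 hKpt.lt_top⟩
  -- (3) the global class: `A(1) ≤ C`, `E(1) ≤ 3C`
  have hA := SingularProfile.cknAEss_unit_le hu hled
  have hE := SingularProfile.cknE_unit_le hu hled
  unfold cknAEss at hA
  rw [ENNReal.ofReal_one, inv_one] at hA
  simp only [one_mul] at hA
  unfold cknE at hE
  rw [ENNReal.ofReal_one, inv_one, one_mul] at hE
  -- (4) assembly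
  refine ⟨p, ⟨classPressure_suitable_meanFree hq, ⟨C.toNNReal, ?_⟩,
    ⟨fun t x => fderiv ℝ (u t) x, hasWeakSpatialGradientOn_of_contDiffOn isOpen_Iio
      (parabolicCylinder_origin_subset_slab 1) (hu.contDiffOn.of_le (by norm_cast)), ?_⟩, hpLp⟩,
    hu3.trans le_self_add, hp32.trans le_add_self⟩
  · filter_upwards [ENNReal.ae_le_essSup fun t : ℝ =>
      ∫⁻ x in ball (0 : ℝ × E3).2 1, ‖u t x‖ₑ ^ 2] with t ht
    exact ht.trans hA
  · exact lt_of_le_of_lt hE ENNReal.ofReal_lt_top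

/-! ### The stub -/

/-- **Stub 6 `stub_classPressure` of the birth line of `ClockLaw`** (`PressureRepr → ClassPressure`,
statements unfolded verbatim): every Type-I KNSS-mild field with the energy ledger `A, E ≤ C` is,
with some pressure, a suitable weak solution in the unit parabolic ball (Albritton–Barker Def. 2.1)
with `‖u‖_{L³(Q(0,1))}, ‖p‖_{L^{3/2}(Q(0,1))} ≤ K(C)`. The antecedent (a pressure representation on
`Q(0,2)` through the cut-off Riesz pressure) is not needed: the consequent holds outright
(`classPressure_holds`). [cite: AlbrittonBarker2019, Def. 2.1, Rem. 3.2 and §3] -/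
theorem stub_classPressure :
    (∃ K₀ : ℝ, ∀ (C : ℝ) (u : ℝ → E3 → E3), IsTypeIAncientMild C u →
      (∀ (x₀ : EuclideanSpace ℝ (Fin 3)) (t₀ r : ℝ), t₀ ≤ 0 → 0 < r →
        (∀ t, t₀ - r ^ 2 < t → t < t₀ → r⁻¹ * ∫ x in Metric.ball x₀ r, ‖u t x‖ ^ 2 ≤ C) ∧
          r⁻¹ * ∫ t in Set.Ioo (t₀ - r ^ 2) t₀, ∫ x in Metric.ball x₀ r, ‖fderiv ℝ (u t) x‖ ^ 2 ≤ C) →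
      ∃ p : ℝ → E3 → ℝ,
        IsDistributionalNSSolutionOn (parabolicCylinderOpens 2 (0 : ℝ × E3)) 1 0 u p ∧
        AEStronglyMeasurable (Function.uncurry p)
            (volume.restrict (parabolicCylinder 2 (0 : ℝ × E3))) ∧
        ∀ t ∈ Set.Ioo (-4 : ℝ) 0, ∀ x ∈ Metric.ball (0 : E3) 2,
          |p t x - normalisedPressure (fun y => ballCutoff 0 2 y • u t y) x| ≤ K₀ * C) →
    ∀ C : ℝ, ∃ K : NNReal, ∀ u : ℝ → E3 → E3, IsTypeIAncientMild C u →
      (∀ (x₀ : EuclideanSpace ℝ (Fin 3)) (t₀ r : ℝ), t₀ ≤ 0 → 0 < r →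
        (∀ t, t₀ - r ^ 2 < t → t < t₀ → r⁻¹ * ∫ x in Metric.ball x₀ r, ‖u t x‖ ^ 2 ≤ C) ∧
          r⁻¹ * ∫ t in Set.Ioo (t₀ - r ^ 2) t₀, ∫ x in Metric.ball x₀ r, ‖fderiv ℝ (u t) x‖ ^ 2 ≤ C) →
      ∃ p : ℝ → E3 → ℝ, IsSuitableWeakSolutionInBall 1 0 u p ∧
        eLpNorm (Function.uncurry u) 3
            (volume.restrict (parabolicCylinder 1 (0 : ℝ × E3))) ≤ K ∧
        eLpNorm (Function.uncurry p) (3 / 2)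
            (volume.restrict (parabolicCylinder 1 (0 : ℝ × E3))) ≤ K :=
  fun _ => classPressure_holds

end Summit.NavierStokesRegularity.NavierStokesRegularity.Theorems.ClockLaw.Birth

end
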